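import Mathlib
import Literature.MathematicalPhysics.StatisticalMechanics.LocalMatchingCompactness

/-!
# `FiveFoldRationingR` (stmt-AtomisticToContinuum-18071), line `Sketch` — stub `stub_ffrRelDense`:
# all-gapped-twelve sets without free surface are `3a`-relatively dense

Support file for the skeleton of the crux `GappedShellCensus.FiveFoldRationingR`. A non-empty set
`Y ⊆ ℝ³` which is all-gapped-twelve at scale `a > 0` (in particular `0.98a`-separated) and has
no free surface (from every site `y`, in every unit direction `e`, some bond partner `w` with
`dist y w ≤ 1.02a` climbs `⟪w - y, e⟫ ≥ 0.18a`) is `3a`-relatively dense: every point `p` of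
space is within `3a` of a site.

Proof (nearest-site argument). `Y` is `0.98a`-separated, so its intersection with a closed ball
is finite and a site `y` nearest to `p` exists. If `ρ = dist p y > 3a`, let `e` be the unit
vector from `y` towards `p`; the no-free-surface hypothesis gives a bond partner `w` with
`‖w - y‖ ≤ 1.02a` and `⟪w - y, p - y⟫ ≥ 0.18aρ`, whence
`dist w p² = ‖w - y‖² - 2⟪w - y, p - y⟫ + ρ² ≤ (1.02a)² - 0.36aρ + ρ² < ρ²` (as `ρ > 3a` and
`0.36 · 3 > 1.0404`) — contradicting the minimality of `y`.
-/

noncomputable section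

namespace Summit.AtomisticToContinuum.Crystallization.Theorems

open Metric
open Literature.MathematicalPhysics.StatisticalMechanics

/-- **Stub (relative denseness without free surface).** A non-empty all-gapped-twelve set at scale
`a > 0` without free surface (every site has, in every unit direction, a bond partner climbing
`≥ 0.18a`) is `3a`-relatively dense: every point of space is within `3a` of a site (a site
nearest to `p` farther than `3a` would have a bond partner strictly nearer to `p`). [folklore] -/
theorem stub_ffrRelDense :
    ∀ (Y : Set (EuclideanSpace ℝ (Fin 3))) (a : ℝ), 0 < a → Y.Nonempty →
      (∀ y ∈ Y, ({w ∈ Y | w ≠ y ∧ dist y w ≤ a * (1 + 1 / 50)}.ncard = 12 ∧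
        ∀ w ∈ Y, w ≠ y → a * (1 - 1 / 50) ≤ dist y w ∧
          (dist y w ≤ a * (1 + 1 / 50) ∨ a * (63 / 50) ≤ dist y w))) →
      (∀ y ∈ Y, ∀ e : EuclideanSpace ℝ (Fin 3), ‖e‖ = 1 →
        ∃ w ∈ Y, w ≠ y ∧ dist y w ≤ a * (1 + 1 / 50) ∧ 9 / 50 * a ≤ inner ℝ (w - y) e) →
      ∀ p : EuclideanSpace ℝ (Fin 3), ∃ y ∈ Y, dist p y ≤ 3 * a := by
  intro Y a ha hne hgap hsurf p
  obtain ⟨z₀, hz₀⟩ := hne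
  -- `Y` is `a(1 - 1/50)`-separated
  have hsep : ∀ u ∈ Y, ∀ v ∈ Y, u ≠ v → a * (1 - 1 / 50) ≤ dist u v :=
    fun u hu v hv huv => ((hgap u hu).2 v hv (Ne.symm huv)).1
  -- the sites no farther from `p` than `z₀` form a finite non-empty set: minimise the distance
  have hSfin : (Y ∩ closedBall p (dist z₀ p)).Finite :=
    finite_of_forall_le_dist_of_subset_closedBall (by positivity : (0 : ℝ) < a * (1 - 1 / 50))
      (fun u hu v hv huv => hsep u hu.1 v hv.1 huv) Set.inter_subset_right
  have hz₀S : z₀ ∈ hSfin.toFinset := by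
    rw [Set.Finite.mem_toFinset]
    exact ⟨hz₀, mem_closedBall.2 le_rfl⟩
  obtain ⟨y, hyS, hymin⟩ := hSfin.toFinset.exists_min_image (fun u => dist u p) ⟨z₀, hz₀S⟩
  rw [Set.Finite.mem_toFinset] at hyS
  have hyY : y ∈ Y := hyS.1
  have hmin : ∀ z ∈ Y, dist y p ≤ dist z p := by
    intro z hz
    by_cases hzb : dist z p ≤ dist z₀ p
    · exact hymin z ((Set.Finite.mem_toFinset _).2 ⟨hz, mem_closedBall.2 hzb⟩)
    · exact (hymin z₀ hz₀S).trans (le_of_lt (not_le.1 hzb))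
  refine ⟨y, hyY, ?_⟩
  by_contra hρ
  rw [not_le] at hρ
  set ρ := dist p y with hρdef
  have hρ0 : 0 < ρ := by linarith
  have hvn : ‖p - y‖ = ρ := by rw [hρdef, dist_eq_norm]
  -- the unit vector from `y` towards `p`
  have hen : ‖ρ⁻¹ • (p - y)‖ = 1 := by
    rw [norm_smul, norm_inv, Real.norm_eq_abs, abs_of_pos hρ0, hvn, inv_mul_cancel₀ hρ0.ne']
  -- a bond partner `w` of `y` climbing `≥ 0.18a` towards `p`
  obtain ⟨w, hwY, -, hdw, hwe⟩ := hsurf y hyY (ρ⁻¹ • (p - y)) hen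
  have hwn : ‖w - y‖ ≤ a * (1 + 1 / 50) := by rw [← dist_eq_norm, dist_comm]; exact hdw
  have hwv : 9 / 50 * a * ρ ≤ inner ℝ (w - y) (p - y) := by
    rwa [real_inner_smul_right, ← div_eq_inv_mul, le_div_iff₀ hρ0] at hwe
  have hwp : dist w p = ‖(w - y) - (p - y)‖ := by
    rw [sub_sub_sub_cancel_right, dist_eq_norm]
  have hsq : ‖(w - y) - (p - y)‖ ^ 2 < ρ ^ 2 := by
    rw [norm_sub_sq_real, hvn]
    have hp2 : ‖w - y‖ ^ 2 ≤ (a * (1 + 1 / 50)) ^ 2 := pow_le_pow_left₀ (norm_nonneg _) hwn 2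
    have haρ : a * (3 * a) < a * ρ := mul_lt_mul_of_pos_left hρ ha
    nlinarith [hp2, hwv, haρ, sq_nonneg a]
  have hlt : dist w p < ρ := by
    rw [hwp]
    exact lt_of_pow_lt_pow_left₀ 2 hρ0.le hsq
  have hyp : dist y p = ρ := by rw [hρdef, dist_comm]
  exact absurd (hmin w hwY) (by rw [hyp]; exact not_le.2 hlt)

end Summit.AtomisticToContinuum.Crystallization.Theorems
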